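import Summits.QuantumFields.YangMills.Theorems.UnitScaleTiltProp7GreenPiGradientRowOfLetters
import Summits.QuantumFields.YangMills.Theorems.UnitScaleTiltProp7OneFormGreenSupRowsFamily
import Summits.QuantumFields.YangMills.Theorems.UnitScaleTiltProp7ChainPotentialHessianFamily
import Summits.QuantumFields.YangMills.Theorems.UnitScaleTiltProp7OneFormGreenBlockGradientFamily
import Summits.QuantumFields.YangMills.Theorems.UnitScaleTiltProp7OneFormCoerciveHolds
import HarnessLib

/-!
# Route `UnitScaleTilt`, crux K1 «MinimiserStabilityRegPr» (stmt-QuantumFields-19200), EX row (2) `norm_Hπ` — NORM-Hπ-PKG part 1∕2: **THE (∇π) ROW FOR ALL MEMBERS, L-ONLY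
# CONSTANTS** — px21 ✓`Prop7GreenPiGradientRowOfLetters.gradient_row_GTpi_of_letters` (the (115)-gradient row of `G_π = GT … a (DeltaPiSlotP … a) U₀` on sup-bounded sources) AT EVERY
# MEMBER `i : Idx L`, every one of its twelve letters FED BY ITS LANDED FAMILY: `PosOnto(η)`∕`PosOnto(Π)` ⟸ ✓`hco_DeltaEtaSlot_exists`∕✓`hco_DeltaPiSlotP_exists` ∘ ✓`posOnto_of_coercive`;
# FILE C's `hV hDiv` ⟸ px21 ✓`Prop7OneFormGreenSupRowsFamily.valueDiv_GT_DeltaEtaSlot_sup_family`; (c1)(c3) ⟸ px17 ✓`Prop7ChainPotentialHessianFamily.hc1_hc3_sup_family`; (c2) ⟸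
# ✓`hc2_sup_family`; (H∇) ⟸ ✓`hessRow_chain_family`; (∇0) ⟸ px21 ✓`Prop7OneFormGreenBlockGradientFamily.gradient_GT_DeltaEtaSlot_family`; the α-window `hwin` ⟸ the cap (§1).
# (width seat `ym3-torus-px21` g16; CLAIM 14:50:12Z «NORM-Hπ-PKG = census row (2) as an ∃-package».)

Cell `ym3-torus` (HUMAN RULING D-0037; rung R3 = SU(2) YM₃ on T³ — NOT d = 4, NOT infinite volume, NOT a mass gap, NOT Clay).  THEOREMS ONLY (0 `def`, 0 `sorry`);
`--supports stmt-QuantumFields-19200 --as helper`; count-neutral.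

WHAT IS PROVED (ns `Summit.QuantumFields.YangMills.Theorems.Prop7GreenPiGradientFamily`).
* §1 ★ `hwin_of_cap` — FILE C's α-window `4αC₁(BV+BD) + 12αC₃(1+C₂)(1+C₂+4αC₁(BV+BD)) ≤ ½` from `0 ≤ α ≤ 1` and `α·(2W+1) ≤ 1`, `W := 4C₁(BV+BD) + 12C₃(1+C₂)(1+C₂+4C₁(BV+BD))`
  (pure reals).
* §2 ★★★ `gradient_GTpi_family_exists` — for L-only weights `c₀ cB : ℕ → ℝ` (positive) and a coupling window `0 < a₀ ≤ a₁`: `∃ αG BGπ : ℕ → ℝ` (cap with the three windows of record,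
  `αG L ≤ 1`, `0 ≤ BGπ L`) such that for every `L > 1`, member `i : Idx L`, background `U₀` with `RegPr ρ U₀`, `ρ ≤ αG L`, under `Lift`, GIVEN THE MEMBER'S NO-WRAP ROOM (displayed while
  the (c2)∕(H∇)∕(∇0)∕`hDiv` families carry it — their `_allMembers` editions ✓p776807∕⧗ remove it; R-edition of this file by generator), every coupling `a₀(c₀∕cB)ℓ³ ≤ a ≤ a₁(c₀∕cB)ℓ³`:
  `∀ X s, (∀ b, ‖X b‖ ≤ s) → ‖nabla115 ((L⁻¹)^(K−n)) (bgOfCfg U₀) (fun q => toL2⁻¹(G_π(toL2 X)) (bondEquiv⁻¹ q))‖ ≤ BGπ L * s` — the `hG` slot of ✓`gradient_row_HT_of_gradient_row` at the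
  Π-slot for every member ([Balaban1985BackgroundPropagators] Thm 3.12 (3.42)∕(3.130)–(3.133): the (115)-gradient row of `G` (3.122), L-only `B`).
  `BGπ L := BG L·(1 + 8αC₁(BV+BD) + 96α²C₁C₃(1+C₂)(BV+BD)) + BH L·24α(1+C₂)(BV+BD)` at `α := αG L`.
HYP-SAT (★★OWNER RULING №42).  Nothing displayed beyond `RegPr`∕cap∕`Lift`∕ROOM∕coupling window (classes of record); every letter of the member theorem is discharged by a landed family;
conclusion non-vacuous; no `Prop` placeholder.
HONEST SCOPE.  An `∃`-assembly over landed families; constants EXISTENTIAL-but-L-only; nothing of `hGπ`'s K-storey half, `norm_Hπ`, `h133`, the EX rows, EX or the crux is proved here;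
no summit is proved by a helper; the Yang–Mills mass gap is NOT proved.

References: T. Bałaban, CMP **99** (1985) 389–434 [Balaban1985BackgroundPropagators] ((3.3) p.391, (3.117)–(3.122) pp.419–420, (3.130)–(3.133) pp.421–422, Thm 3.12 p.423);
CMP **102** (1985) 277–309 [Balaban1985Variational] (Thm 1 p.279 (L-only constants), (115)–(117) pp.294–295).
-/

set_option autoImplicit false

noncomputable section

open scoped Matrix.Norms.L2Operator BigOperators InnerProductSpace ComplexConjugate

namespace Summit.QuantumFields.YangMills.Theorems.Prop7GreenPiGradientFamily

open Literature.MathematicalPhysics.QuantumFieldTheory.Balaban1983to89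
open Literature.MathematicalPhysics.QuantumFieldTheory.Balaban1983to89.T3ContinuumYM3Torus
open Literature.MathematicalPhysics.QuantumFieldTheory.Balaban1983to89.T3PrintedRegularMinimiser (RegPr)
open Literature.MathematicalPhysics.QuantumFieldTheory.Balaban1983to89.T3PrintedMinimiserExistence (regPr_mono)
open B15DeterminingSets (embIter)
open T3SectALandauChart (bgUnits)
open B9SectCLatticeCarrier (Bond)
open B11Eq111FrakG (nabla115)
open B11Eq103H1Complex (SiteL2K BondL2K)
open Summit.QuantumFields.YangMills.Theorems.Prop8Chart (emlIterU)
open Summit.QuantumFields.YangMills.Theorems.Prop7SectET3Transport (periodsT3 bondEquiv bgOfCfg)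
open Summit.QuantumFields.YangMills.Theorems.Prop7SectET3HilbertLetters (W₂ toL2 toL2S DL2 DstarL2)
open Summit.QuantumFields.YangMills.Theorems.Prop7SectET3GaugeProjector (RS)
open Summit.QuantumFields.YangMills.Theorems.Prop7SectET3WilsonHessian (DeltaEtaSlot)
open Summit.QuantumFields.YangMills.Theorems.Prop7SectET3CurvedPropagators (GT PosOnto)
open Summit.QuantumFields.YangMills.Theorems.Prop7SectET3DeltaPiPInv (GprimeP DeltaPiSlotP)
open Summit.QuantumFields.YangMills.Theorems.Prop7CurvedMemberLocalGradient (exists_curved_localGradient)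
open Summit.QuantumFields.YangMills.Theorems.Prop7OneFormCoerciveHolds (hco_DeltaEtaSlot_exists hco_DeltaPiSlotP_exists posOnto_of_coercive)
open Summit.QuantumFields.YangMills.Theorems.Prop7OneFormGreenSupRowsFamily (valueDiv_GT_DeltaEtaSlot_sup_family)
open Summit.QuantumFields.YangMills.Theorems.Prop7ChainPotentialHessianFamily (alphaH_pos hc1_hc3_sup_family hc2_sup_family hessRow_chain_family)
open Summit.QuantumFields.YangMills.Theorems.Prop7OneFormGreenBlockGradientFamily (gradient_GT_DeltaEtaSlot_family)
open Summit.QuantumFields.YangMills.Theorems.Prop7GreenPiGradientRowOfLetters (gradient_row_GTpi_of_letters)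

/-! ## §1 FILE C's α-window from a cap (pure reals) -/

/-- ★ FILE C's α-window from `0 ≤ α ≤ 1` and `α·(2W + 1) ≤ 1`, `W := 4C₁(BV+BD) + 12C₃(1+C₂)(1+C₂+4C₁(BV+BD))`. [folklore] -/
theorem hwin_of_cap {α C₁ C₂ C₃ B : ℝ} (hα : 0 ≤ α) (hα1 : α ≤ 1) (hC₁ : 0 ≤ C₁) (hC₂ : 0 ≤ C₂) (hC₃ : 0 ≤ C₃) (hB : 0 ≤ B)
    (hcap : α * (2 * (4 * C₁ * B + 12 * C₃ * (1 + C₂) * (1 + C₂ + 4 * C₁ * B)) + 1) ≤ 1) :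
    4 * α * C₁ * B + 12 * α * C₃ * (1 + C₂) * (1 + C₂ + 4 * α * C₁ * B) ≤ 1 / 2 := by
  have h1 : 4 * α * C₁ * B ≤ 4 * C₁ * B := by nlinarith [mul_nonneg hC₁ hB]
  have h2 : 12 * α * C₃ * (1 + C₂) * (1 + C₂ + 4 * α * C₁ * B) ≤ α * (12 * C₃ * (1 + C₂) * (1 + C₂ + 4 * C₁ * B)) := by
    have h3 : 0 ≤ 12 * α * C₃ * (1 + C₂) := by positivity
    nlinarith [mul_le_mul_of_nonneg_left (show 1 + C₂ + 4 * α * C₁ * B ≤ 1 + C₂ + 4 * C₁ * B by linarith) h3]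
  have hW : 0 ≤ 4 * C₁ * B + 12 * C₃ * (1 + C₂) * (1 + C₂ + 4 * C₁ * B) := by positivity
  nlinarith

/-! ## §2 ★★★ The (∇π) row for all members -/

/-- ★★★ **THE (∇π) ROW OF `G_π` ON SUP-BOUNDED SOURCES FOR ALL MEMBERS WITH ROOM, L-ONLY CONSTANTS** — ✓`gradient_row_GTpi_of_letters` at every member, its letters fed by the landed
families (`PosOnto` ×2, `hV hDiv`, (c1)(c2)(c3), `hwin`, (∇0), (H∇)); `∃ αG BGπ : ℕ → ℝ` with the three windows of record and `αG L ≤ 1`.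
[cite: Balaban1985BackgroundPropagators, (3.3) p.391, (3.117)–(3.122) pp.419–420, (3.130)–(3.133) pp.421–422, Thm 3.12 p.423; Balaban1985Variational, Thm 1 p.279, (115)–(117) pp.294–295] -/
theorem gradient_GTpi_family_exists (c₀ cB : ℕ → ℝ) [hc₀ : ∀ L : ℕ, Fact (0 < c₀ L)] [hcB : ∀ L : ℕ, Fact (0 < cB L)] {a₀ a₁ : ℝ} (ha₀ : 0 < a₀) (ha₀₁ : a₀ ≤ a₁) :
    ∃ (αG BGπ : ℕ → ℝ),
      (∀ L : ℕ, 1 < L → 0 < αG L) ∧ (∀ L : ℕ, 1 < L → 10 ^ 12 * (L : ℝ) ^ 3 * αG L ≤ 1) ∧ (∀ L : ℕ, 1 < L → 10 ^ 10 * (L : ℝ) ^ 6 * αG L ≤ 1) ∧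
      (∀ L : ℕ, 1 < L → 13 * 10 ^ 14 * (L : ℝ) ^ 3 * αG L ≤ 1) ∧ (∀ L : ℕ, 1 < L → αG L ≤ 1) ∧ (∀ L : ℕ, 1 < L → 0 ≤ BGπ L) ∧
    ∀ (L : ℕ), 1 < L → ∀ (i : T3Thm1Carrier.Idx L) (U₀ : GaugeField (i.1.1.P i.1.2.2) 0 (Matrix.specialUnitaryGroup (Fin 2) ℂ)), ∀ ρ : ℝ, RegPr i.1.1 i.1.2.1 i.1.2.2 ρ U₀ → ρ ≤ αG L →
        (∀ cf : Site (i.1.1.P i.1.2.2) (i.1.2.2 - i.1.2.1) → Matrix (Fin 2) (Fin 2) ℂ,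
        (∀ e' : PBond (i.1.1.P i.1.2.2) (i.1.2.2 - i.1.2.1), cf e'.src = ((emlIterU (i.1.2.2 - i.1.2.1) (bgUnits i.1.1 i.1.2.2 U₀) e' : (Matrix (Fin 2) (Fin 2) ℂ)ˣ) : Matrix (Fin 2) (Fin 2) ℂ) * cf e'.tgt *
        (((emlIterU (i.1.2.2 - i.1.2.1) (bgUnits i.1.1 i.1.2.2 U₀) e')⁻¹ : (Matrix (Fin 2) (Fin 2) ℂ)ˣ) : Matrix (Fin 2) (Fin 2) ℂ)) →
        ∃ l₀ : Site (i.1.1.P i.1.2.2) 0 → Matrix (Fin 2) (Fin 2) ℂ,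
        (∀ b' : PBond (i.1.1.P i.1.2.2) 0, l₀ b'.src = ((bgUnits i.1.1 i.1.2.2 U₀ b' : (Matrix (Fin 2) (Fin 2) ℂ)ˣ) : Matrix (Fin 2) (Fin 2) ℂ) * l₀ b'.tgt * (((bgUnits i.1.1 i.1.2.2 U₀ b')⁻¹ : (Matrix (Fin 2) (Fin 2) ℂ)ˣ) : Matrix (Fin 2) (Fin 2) ℂ)) ∧
        ∀ y : Site (i.1.1.P i.1.2.2) (i.1.2.2 - i.1.2.1), l₀ (embIter (i.1.2.2 - i.1.2.1) y) = cf y) →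
      2 * (12 * i.1.1.L ^ (i.1.2.2 - i.1.2.1) + 5) ≤ (i.1.1.P i.1.2.2).sitesPerDir 0 →
      ∀ a : ℝ, a₀ * (c₀ L / cB L) * ((i.1.1.L : ℝ) ^ (i.1.2.2 - i.1.2.1)) ^ 3 ≤ a → a ≤ a₁ * (c₀ L / cB L) * ((i.1.1.L : ℝ) ^ (i.1.2.2 - i.1.2.1)) ^ 3 →
      ∀ (X : PBond (i.1.1.P i.1.2.2) 0 → Matrix (Fin 2) (Fin 2) ℂ) (s : ℝ), (∀ b, ‖X b‖ ≤ s) →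
        ‖nabla115 (((i.1.1.L : ℝ)⁻¹) ^ (i.1.2.2 - i.1.2.1)) (bgOfCfg i.1.1 i.1.2.2 U₀)
            (fun q : Bond 3 (periodsT3 i.1.1 i.1.2.2) => (toL2 i.1.1 i.1.2.2 (c₀ L)).symm (GT i.1.1 i.1.2.1 i.1.2.2 i.2.2.le (c₀ L) (cB L) a
              (DeltaPiSlotP i.1.1 i.1.2.1 i.1.2.2 i.2.2.le (c₀ L) (cB L) a) U₀ (toL2 i.1.1 i.1.2.2 (c₀ L) X)) ((bondEquiv i.1.1 i.1.2.2).symm q))‖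
          ≤ BGπ L * s := by
  -- the landed families
  obtain ⟨αco, γco, hαco, hWco, hwinco, hγco, hco⟩ := hco_DeltaEtaSlot_exists c₀ cB ha₀
  obtain ⟨αcp, γcp, hαcp, hWcp, hwincp, hγcp, hcp⟩ := hco_DeltaPiSlotP_exists c₀ cB ha₀
  obtain ⟨αS, BV, BD, hαS, hWS12, hWS10, hWS13, hBV, hBD, hS⟩ := valueDiv_GT_DeltaEtaSlot_sup_family c₀ cB ha₀ ha₀₁
  obtain ⟨C₁, C₃, hC₁, hC₃, hc13⟩ := hc1_hc3_sup_family c₀ cB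
  obtain ⟨C₂, hC₂, hc2⟩ := hc2_sup_family c₀ cB
  obtain ⟨αH, BH, hαH, hWH, hBH, hHD⟩ := hessRow_chain_family c₀ cB
  obtain ⟨αN, BG, hαN, hWN12, hWN10, hWN13, hBG, hG0⟩ := gradient_GT_DeltaEtaSlot_family c₀ cB ha₀ ha₀₁
  -- the window modulus and the cap
  set W : ℕ → ℝ := fun L => 4 * C₁ L * (BV L + BD L) + 12 * C₃ L * (1 + C₂ L) * (1 + C₂ L + 4 * C₁ L * (BV L + BD L)) with hWd
  have hW0 : ∀ L : ℕ, 1 < L → 0 ≤ W L := fun L hL => by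
    have := hC₁ L hL; have := hC₂ L hL; have := hC₃ L hL; have := hBV L hL; have := hBD L hL
    simp only [hWd]; positivity
  set αG : ℕ → ℝ := fun L => min (min (min (min (αco L) (αcp L)) (min (αS L) (αN L))) (min (αH L) (min (1 / (10 ^ 12 * (L : ℝ) ^ 3)) (1 / (2 * ((exists_curved_localGradient.choose + 1) * (48 * (6 * Real.sqrt 2 * Real.sqrt 10 + 6 * Real.sqrt 2))))))))
    (min 1 (1 / (2 * W L + 1))) with hαG
  have hαG0 : ∀ L : ℕ, 1 < L → 0 < αG L := fun L hL => by
    have := hαco L hL; have := hαcp L hL; have := hαS L hL; have := hαN L hL; have := hαH L hL; have := alphaH_pos L hL; have := hW0 L hL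
    simp only [hαG]
    exact lt_min (lt_min (lt_min (lt_min (by assumption) (by assumption)) (lt_min (by assumption) (by assumption))) (lt_min (by assumption) (by assumption)))
      (lt_min one_pos (by positivity))
  have hαco' : ∀ L, αG L ≤ αco L := fun L => by simp only [hαG]; exact (min_le_left _ _).trans ((min_le_left _ _).trans ((min_le_left _ _).trans (min_le_left _ _)))
  have hαcp' : ∀ L, αG L ≤ αcp L := fun L => by simp only [hαG]; exact (min_le_left _ _).trans ((min_le_left _ _).trans ((min_le_left _ _).trans (min_le_right _ _)))
  have hαS' : ∀ L, αG L ≤ αS L := fun L => by simp only [hαG]; exact (min_le_left _ _).trans ((min_le_left _ _).trans ((min_le_right _ _).trans (min_le_left _ _)))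
  have hαN' : ∀ L, αG L ≤ αN L := fun L => by simp only [hαG]; exact (min_le_left _ _).trans ((min_le_left _ _).trans ((min_le_right _ _).trans (min_le_right _ _)))
  have hαH' : ∀ L, αG L ≤ αH L := fun L => by simp only [hαG]; exact (min_le_left _ _).trans ((min_le_right _ _).trans (min_le_left _ _))
  have hαX' : ∀ L, αG L ≤ min (1 / (10 ^ 12 * (L : ℝ) ^ 3)) (1 / (2 * ((exists_curved_localGradient.choose + 1) * (48 * (6 * Real.sqrt 2 * Real.sqrt 10 + 6 * Real.sqrt 2))))) := fun L => by
    simp only [hαG]; exact (min_le_left _ _).trans ((min_le_right _ _).trans (min_le_right _ _))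
  have hα1 : ∀ L, αG L ≤ 1 := fun L => by simp only [hαG]; exact (min_le_right _ _).trans (min_le_left _ _)
  have hαW : ∀ L, αG L ≤ 1 / (2 * W L + 1) := fun L => by simp only [hαG]; exact (min_le_right _ _).trans (min_le_right _ _)
  refine ⟨αG, fun L => BG L * (1 + 8 * αG L * C₁ L * (BV L + BD L) + 96 * αG L ^ 2 * C₁ L * C₃ L * (1 + C₂ L) * (BV L + BD L)) + BH L * (24 * αG L * (1 + C₂ L) * (BV L + BD L)),
    hαG0, fun L hL => ?_, fun L hL => ?_, fun L hL => ?_, fun L _ => hα1 L, fun L hL => ?_, ?_⟩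
  · exact (mul_le_mul_of_nonneg_left (hαco' L) (by positivity)).trans (hWco L hL)
  · exact (mul_le_mul_of_nonneg_left (hαS' L) (by positivity)).trans (hWS10 L hL)
  · exact (mul_le_mul_of_nonneg_left (hαco' L) (by positivity)).trans (hwinco L hL)
  · have := hBG L hL; have := hBH L hL; have := hC₁ L hL; have := hC₂ L hL; have := hC₃ L hL; have := hBV L hL; have := hBD L hL; have := (hαG0 L hL).le
    positivity
  -- the member
  intro L hL i U₀ ρ hreg hρ hlift hroom a ha₀a ha₁a X s hX
  have hc₀L : 0 < c₀ L := (hc₀ L).out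
  have hcBL : 0 < cB L := (hcB L).out
  have hL0 : (0 : ℝ) < L := by exact_mod_cast lt_trans zero_lt_one hL
  have hLL : (L : ℝ) = (i.1.1.L : ℝ) := by rw [i.2.1]
  have hαL := hαG0 L hL
  have ha : 0 ≤ a := le_trans (by positivity) ha₀a
  have hregG : RegPr i.1.1 i.1.2.1 i.1.2.2 (αG L) U₀ := regPr_mono i.1.1 hρ hreg
  -- the window of record at this member
  have hw13 : 13 * 10 ^ 14 * (i.1.1.L : ℝ) ^ 3 * αG L ≤ 1 := by
    rw [← hLL]; exact (mul_le_mul_of_nonneg_left (hαco' L) (by positivity)).trans (hwinco L hL)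
  -- PosOnto at the two slots
  have hp₀ : PosOnto i.1.1 i.1.2.1 i.1.2.2 i.2.2.le (c₀ L) (cB L) a (DeltaEtaSlot i.1.1 i.1.2.1 i.1.2.2 (c₀ L)) U₀ :=
    posOnto_of_coercive i.2.2.le (cB L) i.2.2 hregG hw13 (hγco L hL) _ (hco L hL i U₀ ρ hreg (hρ.trans (hαco' L)) hlift a ha₀a)
  have hpπ : PosOnto i.1.1 i.1.2.1 i.1.2.2 i.2.2.le (c₀ L) (cB L) a (DeltaPiSlotP i.1.1 i.1.2.1 i.1.2.2 i.2.2.le (c₀ L) (cB L) a) U₀ :=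
    posOnto_of_coercive i.2.2.le (cB L) i.2.2 hregG hw13 (hγcp L hL) _ (hcp L hL i U₀ ρ hreg (hρ.trans (hαcp' L)) hlift a ha₀a)
  -- the letters at this member
  obtain ⟨hV, hDiv⟩ := hS L hL i U₀ ρ hreg (hρ.trans (hαS' L)) hlift a ha₀a ha₁a hroom
  have hc13m := hc13 L hL i U₀ ρ hreg (hρ.trans (hαX' L)) hlift a ha
  have hc1 := fun (w : Site (i.1.1.P i.1.2.2) 0 → Matrix (Fin 2) (Fin 2) ℂ) (m' : ℝ) (hw : ∀ x, ‖w x‖ ≤ m') => (hc13m w m' hw).1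
  have hc3 := fun (w : Site (i.1.1.P i.1.2.2) 0 → Matrix (Fin 2) (Fin 2) ℂ) (m' : ℝ) (hw : ∀ x, ‖w x‖ ≤ m') => (hc13m w m' hw).2
  have hc2m := hc2 L hL i U₀ ρ hreg (hρ.trans (hαX' L)) hlift hroom a ha
  have hHDm := hHD L hL i U₀ ρ hreg (hρ.trans (hαH' L)) hlift hroom a ha
  have hG0m := hG0 L hL i U₀ ρ hreg (hρ.trans (hαN' L)) hlift a ha₀a ha₁a hroom
  have hwin : 4 * αG L * C₁ L * (BV L + BD L) + 12 * αG L * C₃ L * (1 + C₂ L) * (1 + C₂ L + 4 * αG L * C₁ L * (BV L + BD L)) ≤ 1 / 2 := by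
    refine hwin_of_cap hαL.le (hα1 L) (hC₁ L hL) (hC₂ L hL) (hC₃ L hL) (add_nonneg (hBV L hL) (hBD L hL)) ?_
    have hWL := hW0 L hL
    have h1 := hαW L
    rw [le_div_iff₀ (by positivity)] at h1
    simpa only [hWd] using h1
  exact gradient_row_GTpi_of_letters U₀ hregG ha hp₀ hpπ (hBV L hL) (hBD L hL) (hC₁ L hL) (hC₂ L hL) (hC₃ L hL) hV hDiv hc1 hc2m hc3 hwin hG0m hHDm X s hX

end Summit.QuantumFields.YangMills.Theorems.Prop7GreenPiGradientFamily

end
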